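import Summits.ABC.ABC.Theorems.SomeWindowSaving.Negative.WindowFinite
import Literature.NumberTheory.EllipticCurves.SzpiroLocalDataProofs

/-!
# Load-bearing analysis of the parameter constraints of crux `TwistAmplification.SomeWindowSaving`

Negative-side support (cdisprove of stmt-ABC-1976).  For an `∃`-crux, dropping a constraint on the
parameters can only make the statement easier; each of `3 < κ`, `κ < σ`, `δ < (σ−κ)/(2σ−6)` is what
keeps the crux from being trivially provable — without any one of them a junk witness exists
(`someWindowSaving_trivial_without_lowerKappa/upperSigma/threshold`).  Tools:
`no_model_with_unit_invariants` (`|Δ| = |c₄| = 1` is impossible over `ℤ`) and the trivial box bound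
`windowCount_le_trivial : T⁺_[κ,σ](X) ≤ 143742252 · X^{2σ}` (`σ ≥ 0`, `X ≥ 1`).
-/

noncomputable section

open UniqueFactorizationMonoid IsDedekindDomain Real WeierstrassCurve

namespace Summit.ABC.ABC.Theorems.SomeWindowSaving.Negative

section LoadBearing

/-- No integral Weierstrass model has `|Δ| = 1` and `|c₄| = 1`: `c₆² = c₄³ − 1728Δ ∈ {±1727, ±1729}`
is never a square. -/
theorem no_model_with_unit_invariants (W : WeierstrassCurve ℤ) (hΔ : |W.Δ| = 1) (hc₄ : |W.c₄| = 1) :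
    False := by
  have hrel : W.c₆ ^ 2 = W.c₄ ^ 3 - 1728 * W.Δ := by have := W.c_relation; linarith
  have hsq : (W.c₆.natAbs : ℤ) ^ 2 = W.c₆ ^ 2 := Int.natAbs_sq W.c₆
  set n := W.c₆.natAbs with hn
  have hcases : (n : ℤ) ^ 2 = 1729 ∨ (n : ℤ) ^ 2 = 1727 ∨ (n : ℤ) ^ 2 = -1727 ∨ (n : ℤ) ^ 2 = -1729 := by
    rcases abs_eq (zero_le_one) |>.mp hΔ with h1 | h1 <;>
      rcases abs_eq (zero_le_one) |>.mp hc₄ with h2 | h2 <;>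
      · rw [hsq, hrel, h1, h2]; norm_num
  have hn42 : n ≤ 42 := by
    by_contra h
    have h43 : (43 : ℤ) ≤ n := by exact_mod_cast (by omega : 43 ≤ n)
    rcases hcases with h | h | h | h <;> nlinarith
  have hcases' : n ^ 2 = 1729 ∨ n ^ 2 = 1727 := by
    rcases hcases with h | h | h | h
    · left; exact_mod_cast h
    · right; exact_mod_cast h
    · nlinarith
    · nlinarith
  interval_cases n <;> omega

/-- A member of a window slice with `M⁺ ≤ 1` does not exist (`|Δ| ≥ 1` forces `M⁺ = |Δ| = |c₄|³ = 1`
up to `c₄ ≠ 0`, contradicting `no_model_with_unit_invariants`). -/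
theorem not_mem_windowSet_of_maxInv_le_one {κ σ X : ℝ} {W : WeierstrassCurve ℤ}
    (h : W ∈ windowSet κ σ X) (hM : ((max |W.Δ| (|W.c₄| ^ 3) : ℤ) : ℝ) ≤ 1) : False := by
  obtain ⟨hE, -, -, -, -, hc₄, -, -, -, -⟩ := h
  have hΔ0 : W.Δ ≠ 0 := Δ_ne_zero_of_isElliptic_baseChange_int W
  have hM' : max |W.Δ| (|W.c₄| ^ 3) ≤ 1 := by exact_mod_cast hM
  have hΔ1 : 1 ≤ |W.Δ| := Int.one_le_abs hΔ0
  have hc1 : 1 ≤ |W.c₄| := Int.one_le_abs hc₄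
  have hΔle : |W.Δ| ≤ 1 := le_trans (le_max_left _ _) hM'
  have hcle : |W.c₄| ^ 3 ≤ 1 := le_trans (le_max_right _ _) hM'
  have hc : |W.c₄| = 1 := by
    refine le_antisymm ?_ hc1
    by_contra hlt
    have h2 : 2 ≤ |W.c₄| := by omega
    have h8 : (2 : ℤ) ^ 3 ≤ |W.c₄| ^ 3 := pow_le_pow_left₀ (by norm_num) h2 3
    linarith
  exact no_model_with_unit_invariants W (le_antisymm hΔle hΔ1) hc

/-- Without `3 < κ`: the window `[κ, σ] = [−2, −1]` is EMPTY (`M⁺ ≤ N^{−1} ≤ 1`), the threshold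
`(σ−κ)/(2σ−6) = −1/8` is beaten by `δ = −1`, `C = 0` — a junk witness. -/
theorem someWindowSaving_trivial_without_lowerKappa :
    ∃ κ σ δ C : ℝ, κ < σ ∧ δ < (σ - κ) / (2 * σ - 6) ∧
      ∀ X : ℝ, 1 ≤ X → (windowCount κ σ X : ℝ) ≤ C * X ^ δ := by
  refine ⟨-2, -1, -1, 0, by norm_num, by norm_num, fun X _ ↦ ?_⟩
  have hempty : windowSet (-2) (-1) X = ∅ := by
    ext W
    simp only [Set.mem_empty_iff_false, iff_false]
    intro hW
    have hW' := hW
    obtain ⟨hE, -, -, -, -, -, -, -, -, hM⟩ := hW'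
    have hN1 : (1 : ℝ) ≤ (((W.baseChange ℚ).conductorNorm ℤ : ℕ) : ℝ) := by
      exact_mod_cast conductorNorm_pos_holds (W.baseChange ℚ)
    exact not_mem_windowSet_of_maxInv_le_one hW
      (hM.trans (Real.rpow_le_one_of_one_le_of_nonpos hN1 (by norm_num)))
  rw [windowCount, hempty, Set.ncard_empty]
  simp

/-- Without `κ < σ`: the window `[κ, σ] = [5, 4]` is EMPTY (`N^5 ≤ M⁺ ≤ N^4` forces `N = 1`,
`M⁺ = 1`), the threshold `(σ−κ)/(2σ−6) = −1/2` is beaten by `δ = −1`, `C = 0`. -/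
theorem someWindowSaving_trivial_without_upperSigma :
    ∃ κ σ δ C : ℝ, 3 < κ ∧ δ < (σ - κ) / (2 * σ - 6) ∧
      ∀ X : ℝ, 1 ≤ X → (windowCount κ σ X : ℝ) ≤ C * X ^ δ := by
  refine ⟨5, 4, -1, 0, by norm_num, by norm_num, fun X _ ↦ ?_⟩
  have hempty : windowSet 5 4 X = ∅ := by
    ext W
    simp only [Set.mem_empty_iff_false, iff_false]
    intro hW
    have hW' := hW
    obtain ⟨hE, -, -, -, -, -, -, -, hlo, hhi⟩ := hW'
    have hN1 : (1 : ℝ) ≤ (((W.baseChange ℚ).conductorNorm ℤ : ℕ) : ℝ) := by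
      exact_mod_cast conductorNorm_pos_holds (W.baseChange ℚ)
    -- `N^5 ≤ N^4` forces `N = 1`, hence `M⁺ ≤ 1`
    have h54 := hlo.trans hhi
    have hNeq : (((W.baseChange ℚ).conductorNorm ℤ : ℕ) : ℝ) = 1 := by
      by_contra hne
      have hlt : (1 : ℝ) < (((W.baseChange ℚ).conductorNorm ℤ : ℕ) : ℝ) := lt_of_le_of_ne hN1 (Ne.symm hne)
      have := Real.rpow_lt_rpow_of_exponent_lt hlt (by norm_num : (4 : ℝ) < 5)
      linarith
    refine not_mem_windowSet_of_maxInv_le_one hW (hhi.trans ?_)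
    rw [hNeq, Real.one_rpow]
  rw [windowCount, hempty, Set.ncard_empty]
  simp

/-- **Trivial upper bound.**  For `σ ≥ 0`, `X ≥ 1`: `T⁺_[κ,σ](X) ≤ 143742252 · X^{2σ}` — the
reduced models in a window inject into the box `|c₄| ≤ X^σ`, `|c₆| ≤ 1729 X^σ`
(`abs_c₄_c₆_le_of_mem`, `covariant_injective`).  Every saving the crux asks for is measured
against this junk bound. -/
theorem windowCount_le_trivial {κ σ X : ℝ} (hσ : 0 ≤ σ) (hX : 1 ≤ X) :
    (windowCount κ σ X : ℝ) ≤ 143742252 * X ^ (2 * σ) := by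
  classical
  set R : ℝ := max (X ^ σ) 1 with hR
  have hR1 : 1 ≤ R := le_max_right _ _
  have hRX : R = X ^ σ := max_eq_left (Real.one_le_rpow hX hσ)
  set T : ℤ := ⌈1729 * R⌉ with hT
  have hT0 : (0 : ℤ) ≤ T := Int.ceil_nonneg (by positivity)
  have hTR : (T : ℝ) < 1729 * R + 1 := Int.ceil_lt_add_one _
  set B : Finset (ℤ × ℤ × ℤ × ℤ × ℤ) :=
    Finset.Icc 0 1 ×ˢ (Finset.Icc (-1) 1 ×ˢ (Finset.Icc 0 1 ×ˢ (Finset.Icc (-T) T ×ˢ Finset.Icc (-T) T)))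
    with hB
  have hmaps : ∀ W ∈ windowSet κ σ X, (fun W : WeierstrassCurve ℤ ↦ (W.a₁, W.a₂, W.a₃, W.c₄, W.c₆)) W ∈
      (B : Set (ℤ × ℤ × ℤ × ℤ × ℤ)) := by
    intro W hW
    obtain ⟨hc₄, hc₆⟩ := abs_c₄_c₆_le_of_mem hW
    obtain ⟨-, -, ha₁, ha₃, ha₂, -⟩ := hW
    have hTz : ∀ z : ℤ, ((|z| : ℤ) : ℝ) ≤ 1729 * R → -T ≤ z ∧ z ≤ T := by
      intro z hz
      have hzT : |z| ≤ T := by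
        have : ((|z| : ℤ) : ℝ) ≤ T := hz.trans (Int.le_ceil _)
        exact_mod_cast this
      exact abs_le.mp hzT
    simp only [hB, Finset.coe_product, Finset.coe_Icc, Set.mem_prod, Set.mem_Icc]
    refine ⟨⟨by omega, by omega⟩, ⟨by omega, by omega⟩, ⟨by omega, by omega⟩,
      hTz _ (hc₄.trans (by linarith)), hTz _ hc₆⟩
  have hle : windowCount κ σ X ≤ B.card := by
    rw [windowCount, ← Set.ncard_coe_finset]
    exact Set.ncard_le_ncard_of_injOn _ hmaps (covariant_injective.injOn) (Finset.finite_toSet B)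
  have hcardZ : (B.card : ℤ) = 2 * 3 * 2 * ((2 * T + 1) * (2 * T + 1)) := by
    rw [hB]
    simp only [Finset.card_product, Int.card_Icc]
    push_cast
    rw [Int.toNat_of_nonneg (by omega : (0 : ℤ) ≤ T + 1 - -T)]
    ring_nf
  have hcard : (B.card : ℝ) = 2 * 3 * 2 * ((2 * (T : ℝ) + 1) * (2 * T + 1)) := by
    exact_mod_cast hcardZ
  calc (windowCount κ σ X : ℝ) ≤ B.card := by exact_mod_cast hle
    _ = 12 * (2 * (T : ℝ) + 1) ^ 2 := by rw [hcard]; ring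
    _ ≤ 12 * (2 * (1729 * R + 1) + 1) ^ 2 := by
        have hT0' : (0 : ℝ) ≤ T := by exact_mod_cast hT0
        have h0 : (0 : ℝ) ≤ 2 * (T : ℝ) + 1 := by linarith
        have h1 : 2 * (T : ℝ) + 1 ≤ 2 * (1729 * R + 1) + 1 := by linarith [hTR.le]
        exact mul_le_mul_of_nonneg_left (pow_le_pow_left₀ h0 h1 2) (by norm_num)
    _ ≤ 12 * (3461 * R) ^ 2 := by
        have h0 : (0 : ℝ) ≤ 2 * (1729 * R + 1) + 1 := by positivity
        have h1 : 2 * (1729 * R + 1) + 1 ≤ 3461 * R := by linarith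
        exact mul_le_mul_of_nonneg_left (pow_le_pow_left₀ h0 h1 2) (by norm_num)
    _ = 143742252 * R ^ 2 := by ring
    _ = 143742252 * X ^ (2 * σ) := by
        rw [hRX, ← Real.rpow_natCast, ← Real.rpow_mul (by linarith)]; congr 1; push_cast; ring_nf

/-- Without `δ < (σ−κ)/(2σ−6)`: the junk exponent `δ = 2σ` of `windowCount_le_trivial` witnesses
the statement (here with `κ = 4`, `σ = 5`). -/
theorem someWindowSaving_trivial_without_threshold :
    ∃ κ σ δ C : ℝ, 3 < κ ∧ κ < σ ∧
      ∀ X : ℝ, 1 ≤ X → (windowCount κ σ X : ℝ) ≤ C * X ^ δ :=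
  ⟨4, 5, 2 * 5, 143742252, by norm_num, by norm_num,
    fun _ hX ↦ windowCount_le_trivial (by norm_num) hX⟩

end LoadBearing

end Summit.ABC.ABC.Theorems.SomeWindowSaving.Negative
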